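import Mathlib
import HarnessLib

/-!
# Venture HSemireg — THEOREM L′ off the flat locus: the independent-transversal identity for LEVEL-UNIFORM margins (W5 seat w5-n6-2 gen 19)

Bookkeeping of the computation cell `pub-hsemireg`, group W5 (notes `widen/W5/SLIVER-w5n62g18.md` §2 (b) and
§7 (2), `widen/W5/FLATTF-w5n62g17.md` §0 ∕ §8 ∕ §9; this leg `widen/W5/KERNEL-M-w5n62g19.md` §9, deposit
`widen/W5/n6code2/v22/marginsI/`). Companion of `FlatIndependentTransversals.lean` (the flat case `μ ≡ d`,
all `t_X = t`: THEOREM L′ as the identity `momentI`) and of `UniformMarginMomentIdentity.lean` (THEOREM M⁺,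
same level-uniform setting); same seat and method; PLAIN, nothing of the tree restated (the Fubini steps
and the pointwise expansion are local `have`s).

SETTING (N7-FEASIBILITY §3.6 (a), FLATTF §0 LEMMA U; as in `UniformMarginMomentIdentity`). Four finite
level types `A, B, C, D` with `t_A, …, t_D` levels, margin functions `μ_X : X → R` over a commutative ring
`R` with `Σ_ξ μ_X(ξ) = m` for `X = A, B, C`, and six torus matrices `xAB, …, xCD` whose line sums through
a level are that level's margin in each of its three matrices (LEVEL-UNIFORM margins). Transversal sums:
`I` = the «no torus» class `Π (1 − x)`, `K₄` = all six tori, `ΣpM` = exactly a perfect matching, `T_XYZ`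
the triangle sums; margin moments `p_X = Σ μ_X²`, `C_X = Σ μ_X³` (N7F §3.8 (a)); the BILINEAR moments
`B_XY = Σ_{x,y} μ_X(x)·xXY(x,y)·μ_Y(y)` (the `ΣB` of N7F §3.8 (a)); and the twelve weighted triangle sums
`Σ_{triangle XYZ} μ_V(v)` (`V` a vertex of the triangle; for `0 ∕ 1` data their sum is the paw count).

* `marginMomentI` — **THEOREM L′⁺**, stated as ONE sum over transversals of `2·[no torus] + [all six]
  − [exactly a perfect matching]`:
  `2·I + K₄ − ΣpM = 2·t_A t_B t_C t_D − 2m·e₂(t) + 3m² + 2 Σ_X (Σ_{W≠X} t_W)·p_X − 2 ΣB − 2 ΣC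
  − 2 Σ_{XYZ} t_W·T_XYZ + ΣPaw` (`e₂(t)` the second elementary symmetric function of the four level
  counts, `W` the coordinate outside the triangle `XYZ`). At `μ ≡ d`, `t_X = t`: `p_X = t d²`,
  `B_XY = C_X = t d³`, `Paw = 3 d·T_tot`, and the right side is `2t⁴ − 12t³d + 27t²d² − 20td³ +
  (3d − 2t)·T_tot` = `FlatIndependentTransversals.momentI`.
  Proof: the pointwise inclusion–exclusion expansion (coefficients `2, −2, 2, 1, −1, −2, −2, +1` on the
  empty graph, edges, 2-paths, matchings, 3-paths, stars, triangles, paws; `0` on the 4-cycles, `K₄ ∖ e`,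
  `K₄` — re-proved inline by `ring`), one sum over transversals, Fubini LEAVES FIRST (a coordinate met by
  one torus is summed out by its line sum `μ`; the two ends of a 3-path go first, leaving `B_XY` on its
  middle torus; the centre of a 2-path ∕ star goes last, leaving `p_X` ∕ `C_X`), one `simp` with the line
  sums, `ring`.

HONEST FRAMING: finite sums and ring arithmetic only; an identity valid for every such family of matrices.
A window for the non-flat sector of the family-S door would combine this with THEOREM M⁺ and the `|S| ≤ 4`
class equations for level-uniform margins (N7F §3.8 (a)), which are NOT formalized here. Nothing in this
file says that HC, HC_CM or HC_AV holds; no door ∕ tier ∕ report sentence of the cell is a consequence of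
this file alone.
-/

namespace Summit.Ventures.HSemireg
namespace UniformMarginIndependentTransversals
open Finset

variable {R : Type*} [CommRing R]
variable {A B C D : Type*} [Fintype A] [Fintype B] [Fintype C] [Fintype D]

/-- **THEOREM L′⁺** (THEOREM L′ of FLATTF-w5n62g17 §8 in the identity form of SLIVER-w5n62g18 §2 (b),
for level-uniform margins). Data: level counts `tA … tD`, margin functions `μA … μD` with totals `m` on
`A, B, C`, six matrices whose line sums through a level are that level's margin (`rXY` rows, `cXY`
columns). Conclusion: summed over the transversals `(a,b,c,e)`, `2·[no torus] + [all six tori] −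
[exactly a perfect matching]` equals `2·tA tB tC tD − 2m·e₂(t) + 3m² + 2 Σ_X (Σ_{W≠X} t_W)·p_X − 2 ΣB
− 2 ΣC − 2 Σ t_W·T_XYZ + ΣPaw`, the bilinear moments `B_XY` and the twelve weighted triangle sums
written in the shape the summation leaves them. -/
theorem marginMomentI (tA tB tC tD m : R) (μA : A → R) (μB : B → R) (μC : C → R) (μD : D → R)
    (xAB : A → B → R) (xAC : A → C → R) (xAD : A → D → R)
    (xBC : B → C → R) (xBD : B → D → R) (xCD : C → D → R)
    (hA : (Fintype.card A : R) = tA) (hB : (Fintype.card B : R) = tB)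
    (hC : (Fintype.card C : R) = tC) (hD : (Fintype.card D : R) = tD)
    (hmA : ∑ a, μA a = m) (hmB : ∑ b, μB b = m) (hmC : ∑ c, μC c = m)
    (rAB : ∀ a, ∑ b, xAB a b = μA a) (cAB : ∀ b, ∑ a, xAB a b = μB b)
    (rAC : ∀ a, ∑ c, xAC a c = μA a) (cAC : ∀ c, ∑ a, xAC a c = μC c)
    (rAD : ∀ a, ∑ e, xAD a e = μA a) (cAD : ∀ e, ∑ a, xAD a e = μD e)
    (rBC : ∀ b, ∑ c, xBC b c = μB b) (cBC : ∀ c, ∑ b, xBC b c = μC c)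
    (rBD : ∀ b, ∑ e, xBD b e = μB b) (cBD : ∀ e, ∑ b, xBD b e = μD e)
    (rCD : ∀ c, ∑ e, xCD c e = μC c) (cCD : ∀ e, ∑ c, xCD c e = μD e) :
    ∑ a, ∑ b, ∑ c, ∑ e,
      (2 * ((1 - xAB a b) * (1 - xAC a c) * (1 - xAD a e) * (1 - xBC b c) * (1 - xBD b e)
          * (1 - xCD c e))
        + xAB a b * xAC a c * xAD a e * xBC b c * xBD b e * xCD c e
        - (xAB a b * xCD c e * (1 - xAC a c) * (1 - xAD a e) * (1 - xBC b c) * (1 - xBD b e)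
          + xAC a c * xBD b e * (1 - xAB a b) * (1 - xAD a e) * (1 - xBC b c) * (1 - xCD c e)
          + xAD a e * xBC b c * (1 - xAB a b) * (1 - xAC a c) * (1 - xBD b e) * (1 - xCD c e)))
      = 2 * (tA * tB * tC * tD)
        - 2 * m * (tA * tB + tA * tC + tA * tD + tB * tC + tB * tD + tC * tD)
        + 3 * m ^ 2
        + 2 * ((tB + tC + tD) * (∑ a, μA a * μA a) + (tA + tC + tD) * (∑ b, μB b * μB b)
          + (tA + tB + tD) * (∑ c, μC c * μC c) + (tA + tB + tC) * (∑ e, μD e * μD e))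
        - 2 * ((∑ a, ∑ b, μA a * xAB a b * μB b) + (∑ a, ∑ c, μA a * xAC a c * μC c)
          + (∑ a, ∑ e, μA a * xAD a e * μD e) + (∑ b, ∑ c, μB b * xBC b c * μC c)
          + (∑ b, ∑ e, μB b * xBD b e * μD e) + (∑ c, ∑ e, μC c * xCD c e * μD e))
        - 2 * ((∑ a, μA a * μA a * μA a) + (∑ b, μB b * μB b * μB b)
          + (∑ c, μC c * μC c * μC c) + (∑ e, μD e * μD e * μD e))
        - 2 * (tD * (∑ a, ∑ b, ∑ c, xAB a b * xAC a c * xBC b c)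
          + tC * (∑ a, ∑ b, ∑ e, xAB a b * xAD a e * xBD b e)
          + tB * (∑ a, ∑ c, ∑ e, xAC a c * xAD a e * xCD c e)
          + tA * (∑ b, ∑ c, ∑ e, xBC b c * xBD b e * xCD c e))
        + ((∑ a, (∑ b, ∑ c, xAB a b * xAC a c * xBC b c) * μA a)
          + (∑ a, ∑ b, (∑ c, xAB a b * xAC a c * xBC b c) * μB b)
          + (∑ a, ∑ b, ∑ c, xAB a b * xAC a c * xBC b c * μC c)
          + (∑ a, (∑ b, ∑ e, xAB a b * xAD a e * xBD b e) * μA a)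
          + (∑ a, ∑ b, (∑ e, xAB a b * xAD a e * xBD b e) * μB b)
          + (∑ a, ∑ b, ∑ e, xAB a b * xAD a e * xBD b e * μD e)
          + (∑ a, (∑ c, ∑ e, xAC a c * xAD a e * xCD c e) * μA a)
          + (∑ a, ∑ c, (∑ e, xAC a c * xAD a e * xCD c e) * μC c)
          + (∑ a, ∑ c, ∑ e, xAC a c * xAD a e * xCD c e * μD e)
          + (∑ b, (∑ c, ∑ e, xBC b c * xBD b e * xCD c e) * μB b)
          + (∑ b, ∑ c, (∑ e, xBC b c * xBD b e * xCD c e) * μC c)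
          + (∑ b, ∑ c, ∑ e, xBC b c * xBD b e * xCD c e * μD e)) := by
  -- Fubini, local (leaves-first orders)
  have sum4_swap12 : ∀ f : A → B → C → D → R,
      ∑ a, ∑ b, ∑ c, ∑ e, f a b c e = ∑ b, ∑ a, ∑ c, ∑ e, f a b c e := fun f => Finset.sum_comm
  have sum4_out3 : ∀ f : A → B → C → D → R,
      ∑ a, ∑ b, ∑ c, ∑ e, f a b c e = ∑ c, ∑ a, ∑ b, ∑ e, f a b c e :=
    fun f => (Finset.sum_congr rfl fun _ _ => Finset.sum_comm).trans Finset.sum_comm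
  have sum4_out4 : ∀ f : A → B → C → D → R,
      ∑ a, ∑ b, ∑ c, ∑ e, f a b c e = ∑ e, ∑ a, ∑ b, ∑ c, f a b c e :=
    fun f => (Finset.sum_congr rfl fun _ _ =>
      (Finset.sum_congr rfl fun _ _ => Finset.sum_comm).trans Finset.sum_comm).trans Finset.sum_comm
  have sum4_swap34 : ∀ f : A → B → C → D → R,
      ∑ a, ∑ b, ∑ c, ∑ e, f a b c e = ∑ a, ∑ b, ∑ e, ∑ c, f a b c e :=
    fun f => Finset.sum_congr rfl fun _ _ => Finset.sum_congr rfl fun _ _ => Finset.sum_comm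
  have sum4_in2 : ∀ f : A → B → C → D → R,
      ∑ a, ∑ b, ∑ c, ∑ e, f a b c e = ∑ a, ∑ c, ∑ e, ∑ b, f a b c e :=
    fun f => Finset.sum_congr rfl fun _ _ =>
      Finset.sum_comm.trans (Finset.sum_congr rfl fun _ _ => Finset.sum_comm)
  have sum4_in1 : ∀ f : A → B → C → D → R,
      ∑ a, ∑ b, ∑ c, ∑ e, f a b c e = ∑ b, ∑ c, ∑ e, ∑ a, f a b c e :=
    fun f => Finset.sum_comm.trans (Finset.sum_congr rfl fun _ _ =>
      Finset.sum_comm.trans (Finset.sum_congr rfl fun _ _ => Finset.sum_comm))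
  have sum4_ae : ∀ f : A → B → C → D → R,
      ∑ a, ∑ b, ∑ c, ∑ e, f a b c e = ∑ a, ∑ e, ∑ b, ∑ c, f a b c e :=
    fun f => Finset.sum_congr rfl fun _ _ =>
      (Finset.sum_congr rfl fun _ _ => Finset.sum_comm).trans Finset.sum_comm
  have sum4_be : ∀ f : A → B → C → D → R,
      ∑ a, ∑ b, ∑ c, ∑ e, f a b c e = ∑ b, ∑ e, ∑ c, ∑ a, f a b c e :=
    fun f => (sum4_in1 f).trans (Finset.sum_congr rfl fun _ _ => Finset.sum_comm)
  have sum4_ce : ∀ f : A → B → C → D → R,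
      ∑ a, ∑ b, ∑ c, ∑ e, f a b c e = ∑ c, ∑ e, ∑ b, ∑ a, f a b c e :=
    fun f => (sum4_in1 f).trans
      (Finset.sum_comm.trans (Finset.sum_congr rfl fun _ _ => Finset.sum_comm))
  -- the pointwise inclusion–exclusion expansion (coefficient table of
  -- `FlatIndependentTransversals.momentI_monomials`; each 3-path written ends-outside so that summing
  -- its two leaves first leaves `μ_X x * xXY x y * μ_Y y` on the middle torus)
  have hpt : ∀ x1 x2 x3 x4 x5 x6 : R,
      2 * ((1 - x1) * (1 - x2) * (1 - x3) * (1 - x4) * (1 - x5) * (1 - x6))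
        + x1 * x2 * x3 * x4 * x5 * x6
        - (x1 * x6 * (1 - x2) * (1 - x3) * (1 - x4) * (1 - x5)
          + x2 * x5 * (1 - x1) * (1 - x3) * (1 - x4) * (1 - x6)
          + x3 * x4 * (1 - x1) * (1 - x2) * (1 - x5) * (1 - x6))
      = 2 - 2 • (x1 + x2 + x3 + x4 + x5 + x6)
        + 2 • (x1 * x2 + x1 * x3 + x2 * x3 + x1 * x4 + x1 * x5 + x4 * x5
          + x2 * x4 + x2 * x6 + x4 * x6 + x3 * x5 + x3 * x6 + x5 * x6)
        + (x1 * x6 + x2 * x5 + x3 * x4)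
        - (x2 * x1 * x5 + x3 * x1 * x4 + x1 * x2 * x6 + x3 * x2 * x4 + x1 * x3 * x6 + x2 * x3 * x5
          + x1 * x4 * x6 + x5 * x4 * x2 + x1 * x5 * x6 + x4 * x5 * x3 + x2 * x6 * x5 + x4 * x6 * x3)
        - 2 • (x1 * x2 * x3 + x1 * x4 * x5 + x2 * x4 * x6 + x3 * x5 * x6)
        - 2 • (x1 * x2 * x4 + x1 * x3 * x5 + x2 * x3 * x6 + x4 * x5 * x6)
        + (x1 * x2 * x4 * x3 + x1 * x2 * x4 * x5 + x1 * x2 * x4 * x6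
          + x1 * x3 * x5 * x2 + x1 * x3 * x5 * x4 + x1 * x3 * x5 * x6
          + x2 * x3 * x6 * x1 + x2 * x3 * x6 * x4 + x2 * x3 * x6 * x5
          + x4 * x5 * x6 * x1 + x4 * x5 * x6 * x2 + x4 * x5 * x6 * x3) := by
    intros; simp only [nsmul_eq_mul, Nat.cast_ofNat]; ring
  simp_rw [hpt]
  simp only [sum_add_distrib, sum_sub_distrib, ← smul_sum]
  -- leaves first
  rw [sum4_swap12 fun a b c _ => xAB a b * xBC b c, sum4_swap12 fun a b _ e => xAB a b * xBD b e,
    sum4_out3 fun a b c _ => xAC a c * xBC b c, sum4_out3 fun a _ c e => xAC a c * xCD c e,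
    sum4_out3 fun _ b c e => xBC b c * xCD c e,
    sum4_out4 fun a b _ e => xAD a e * xBD b e, sum4_out4 fun a _ c e => xAD a e * xCD c e,
    sum4_out4 fun _ b c e => xBD b e * xCD c e,
    sum4_in2 fun a b c e => xAB a b * xAC a c * xCD c e,
    sum4_in2 fun a b c e => xAD a e * xAC a c * xBC b c,
    sum4_ae fun a b c e => xAB a b * xAD a e * xCD c e,
    sum4_ae fun a b c e => xAC a c * xAD a e * xBD b e,
    sum4_in1 fun a b c e => xAB a b * xBC b c * xCD c e,
    sum4_in1 fun a b c e => xBD b e * xBC b c * xAC a c,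
    sum4_be fun a b c e => xAB a b * xBD b e * xCD c e,
    sum4_be fun a b c e => xBC b c * xBD b e * xAD a e,
    sum4_ce fun a b c e => xAC a c * xCD c e * xBD b e,
    sum4_ce fun a b c e => xBC b c * xCD c e * xAD a e,
    sum4_swap12 fun a b c e => xAB a b * xBC b c * xBD b e,
    sum4_out3 fun a b c e => xAC a c * xBC b c * xCD c e,
    sum4_out4 fun a b c e => xAD a e * xBD b e * xCD c e,
    sum4_swap34 fun a b c e => xAB a b * xAD a e * xBD b e * xCD c e,
    sum4_in2 fun a b c e => xAC a c * xAD a e * xCD c e * xBC b c,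
    sum4_in2 fun a b c e => xAC a c * xAD a e * xCD c e * xBD b e,
    sum4_in1 fun a b c e => xBC b c * xBD b e * xCD c e * xAB a b,
    sum4_in1 fun a b c e => xBC b c * xBD b e * xCD c e * xAC a c,
    sum4_in1 fun a b c e => xBC b c * xBD b e * xCD c e * xAD a e]
  simp only [sum_const, card_univ, nsmul_eq_mul, hA, hB, hC, hD, ← mul_sum, ← sum_mul,
    rAB, cAB, rAC, cAC, rAD, cAD, rBC, cBC, rBD, cBD, rCD, cCD, hmA, hmB, hmC, Nat.cast_ofNat]
  ring

end UniformMarginIndependentTransversals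
end Summit.Ventures.HSemireg
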